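import Summits.MatrixMultiplication.MatrixMultiplication.Theses.DefinableSTPPDichotomy

/-!
# Birth vetting of `DefinableSTPPDichotomy.HexagonClearanceR` (stmt-MatrixMultiplication-17884)

Structural findings (refuter, crux-attack at birth, 2026-08-17):

* `hexagonClearanceR_of_not_pairwiseCurvedTilingsLC` : `¬ PairwiseCurvedTilingsLC → HexagonClearanceR`.
  The seam's hypotheses (realised definable family, all ≥2-equal-label patterns, mass `≥ |F|^{m+η}` at
  exponent `(2+ε)/3`, `ε ≤ ε₀`, characteristic `≥ q₁`) are satisfiable for given formulas iff those
  formulas are an LC-witness; so the seam is VACUOUSLY true in the world where the dodge fails, and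
  (contrapositive, `pairwiseCurvedTilingsLC_of_not_hexagonClearanceR`) every refutation of the seam is
  a PROOF of the dodge with the same formulas.  No refutation cheaper than an LC-witness exists.
* `hexagonClearanceR_iff_not_LC_of_not_MM` : if `ω(ℂ) > 2` then `HexagonClearanceR ↔ ¬ PairwiseCurvedTilingsLC`
  (→ is the deciding theorem `closes`, ← is the lemma above).  Hence the seam has content independent of
  the dodge exactly in the world `ω(ℂ) = 2`; it does not restate the summit (`S → R` is not derivable:
  CKSU 5.5 at `ω = 2` bounds `Σ (abc)^{2/3}`, not `Σ (abc)^{(2+ε)/3}`), nor does `R → S` hold absent LC.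

What a refutation of the seam must look like (numerology, for the cdisprove / ideator seats).  Write
`q = |F|`.  Pattern `i=j=k` is the block TPP, so `|A_x||B_x||C_x| ≤ q^m`; the three 2-label patterns
make `A_x − C_x`, `A_x − B_x`, `B_x − C_x` (`x ∈ I`) three PACKINGS of `F^m`, so `Σ ab, Σ bc, Σ ca ≤ q^m`.
By CDM the block sizes are `≍ q^{d_A}, q^{d_B}, q^{d_C}` (integers, finitely many types) and `|I| ≍ q^e`.
(1) bounded blocks (`d = (0,0,0)`): AM–GM `(abc)^{2/3} ≤ (ab+bc+ca)/3` gives mass `≤ K^ε q^m < q^{m+η}`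
    — hypothesis unsatisfiable, seam vacuous there; in particular `m ≤ 2` is vacuous (TPP forces `Σ d ≤ m`).
(2) unequal dimensions: `max pair ≥ 2D/3 + 1/3` (`D = Σ d ≤ m`), so mass `≥ q^{m+η}` needs `ε > 1/D ≥ 1/m`;
    the defender's `ε₀ < 1/m` kills them.  Hence every witness is of type `(d,d,d)`, `d ≥ 1`, `m ≥ 3d`,
    `|I| ≍ q^{m−2d}` up to `q^{−dε+η}`, all three packings tight up to constants, with a pore set of
    size `≥ μ³ q^{3d}` hosting `(A_x − C_x) + (B_x − B_x)∖0` for every `x` — i.e. an LC-witness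
    (translate / frame families give `|I| ≤ q^{m−3d}`, `TranslateFamiliesFail`, full-frame rigidity).
(3) and THEN the clean (fully STPP) sub-families must have density `≤ q^{−η}` in `I` for some FIXED
    `η > 0` of the refuter's choosing: the 3-label violation hypergraph must be power-saving Ramsey
    (Peluse-type nonlinear label relations); linear relations (Behrend, density `q^{−o(1)}`) satisfy
    the seam.
Mutations: `0 < η` is load-bearing (at `η = 0` the singleton family `A_x={x}, B_x={2x}, C_x={4x}`,
`I = F^m`, char `> 3`, meets every hypothesis with mass exactly `q^m`, and `J ⊆ I` can never give
`> q^m`); `ε ≤ ε₀` is load-bearing (only at `ε > 1` do thin label-only parasites reach the mass; in large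
characteristic their LINEAR label relations clear at Behrend cost `q^{−o(1)}`, so a kill of the
`ε₀`-free variant would need a parasite whose hexagon relation is a NONLINEAR progression
`(x, x+y, x+y²)` with a power-saving Roth count (Peluse 2018 / Bourgain–Chang) — plausible, not built); `q₁ ≤ ringChar F`
(vs `card F`) is conservative: without it the seam would assert a "pairwise Thm B" in bounded
characteristic (conclusion impossible there for `ε ≤ 3c_p` by `BCCGNSU2017_thmB_elementary`).
-/

-- `Summit.<Summit>.<Problem>`: single-conjunct summit, the two coincide.
set_option linter.dupNamespace false

namespace Summit.MatrixMultiplication.MatrixMultiplication.Cruxes.HexagonClearanceR.BirthVetting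

open Summit.MatrixMultiplication.MatrixMultiplication.Theses.DefinableSTPPDichotomy

/-- Monotonicity of one mass term in the exponent: bases are natural numbers (`0` or `≥ 1`). -/
theorem rpow_natCast_mono {n : ℕ} {a b : ℝ} (ha : 0 < a) (hab : a ≤ b) :
    (n : ℝ) ^ a ≤ (n : ℝ) ^ b := by
  rcases Nat.eq_zero_or_pos n with h0 | hpos
  · subst h0
    rw [Nat.cast_zero, Real.zero_rpow ha.ne', Real.zero_rpow (by linarith : (0:ℝ) < b).ne']
  · exact Real.rpow_le_rpow_of_exponent_le (by exact_mod_cast hpos) hab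

/-- `¬ LC → R`: the repaired seam holds vacuously unless the dodge succeeds for the given formulas. -/
theorem hexagonClearanceR_of_not_pairwiseCurvedTilingsLC (h : ¬ PairwiseCurvedTilingsLC) :
    HexagonClearanceR := by
  intro e m k φI φA φB φC
  by_contra hR
  apply h
  refine ⟨e, m, k, φI, φA, φB, φC, fun ε hε => ?_⟩
  by_contra hη
  apply hR
  refine ⟨ε, hε, fun ε' η hε' hle hη' => ?_⟩
  by_contra hq
  apply hη
  refine ⟨η, hη', fun q₀ => ?_⟩
  by_contra hF
  apply hq
  refine ⟨q₀, ?_⟩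
  intro F instF instFin instCR hchar y I A B C hI hA hB hC hpair hmass
  exfalso
  apply hF
  refine ⟨F, instF, instFin, instCR, hchar, y, I, A, B, C, hI, hA, hB, hC, hpair, ?_⟩
  calc (Fintype.card F : ℝ) ^ ((m : ℝ) + η)
      ≤ ∑ x ∈ I, (((A x).card * (B x).card * (C x).card : ℕ) : ℝ) ^ ((2 + ε') / 3) := hmass
    _ ≤ ∑ x ∈ I, (((A x).card * (B x).card * (C x).card : ℕ) : ℝ) ^ ((2 + ε) / 3) :=
        Finset.sum_le_sum fun x _ => rpow_natCast_mono (by linarith) (by linarith)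

/-- Contrapositive: any refutation of the seam is a proof of the dodge (same formulas). -/
theorem pairwiseCurvedTilingsLC_of_not_hexagonClearanceR (h : ¬ HexagonClearanceR) :
    PairwiseCurvedTilingsLC := by
  by_contra h'
  exact h (hexagonClearanceR_of_not_pairwiseCurvedTilingsLC h')

/-- Under `ω(ℂ) > 2` the seam is exactly the failure of the dodge. -/
theorem hexagonClearanceR_iff_not_LC_of_not_MM (hS : ¬ _root_.MatrixMultiplication) :
    HexagonClearanceR ↔ ¬ PairwiseCurvedTilingsLC :=
  ⟨fun hR hLC => hS (closes hLC hR), hexagonClearanceR_of_not_pairwiseCurvedTilingsLC⟩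

/-- The route's two cruxes are jointly exhaustive in one direction: `LC ∨ R` always holds. -/
theorem pairwiseCurvedTilingsLC_or_hexagonClearanceR : PairwiseCurvedTilingsLC ∨ HexagonClearanceR := by
  by_cases h : PairwiseCurvedTilingsLC
  · exact Or.inl h
  · exact Or.inr (hexagonClearanceR_of_not_pairwiseCurvedTilingsLC h)

end Summit.MatrixMultiplication.MatrixMultiplication.Cruxes.HexagonClearanceR.BirthVetting
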